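import Literature.NumberTheory.DiophantineApproximation.LeVequeInequality
import Mathlib.Probability.Moments.SubGaussian
import Mathlib.Probability.Independence.Basic
import Mathlib.NumberTheory.Harmonic.Bounds
import Mathlib.Analysis.PSeries
import Mathlib.Analysis.Real.Pi.Bounds
import Mathlib.Tactic
import HarnessLib

/-!
# Measure concentration of the box discrepancy (CDT Theorem 45) via LeVeque + Hoeffding

Calegari–Dimitrov–Tang, arXiv:2408.15403, §4.2 Theorem 45 (p. 42): "There exist two absolute
constants `C, c` such that for any `ε > 0` and any `n`, the set
`B_ε^n := {t ∈ [0,1]ⁿ : D(t) ≥ ε}` has `n`-dimensional Lebesgue measure smaller than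
`C e^{−cε⁴n}`" (for instance `c = 1/300`, `C = 100`), `D` the box discrepancy of Definition 44.
CDT prove it from the Erdős–Turán inequality and Hoeffding's inequality in the circle form of
their Lemma 47: for independent uniformly distributed points `Z₁,…,Z_n` of `𝕋`,
`P(|Z₁ + ⋯ + Z_n| ≥ εn) ≤ 4e^{−ε²n/8}`.

This file proves Theorem 45 with `C = 8`, `c = 1/64`, replacing Erdős–Turán by **LeVeque's
inequality** `D³ ≤ (6/π²) Σ_{h≥1} |S_h/n|²/h²` (`LeVequeInequality.leVeque`), which has the same
shape (character sums, absolute constants): if `D(t) ≥ ε` (`0 < ε ≤ 1`) then, cutting the sum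
at `K = ⌈12/(π²ε³)⌉` (tail `≤ 1/K`) and comparing the head with `Σ_{h≤K} α/h = αH_K`, some
`h ≤ K` has `|S_h|² > αh n²`, `α = π²ε³/(24H_K) ≥ ε⁴/8`; by Lemma 47 (Mathlib's Hoeffding
inequality `HasSubgaussianMGF.measure_sum_ge_le_of_iIndepFun` for the coordinate cosines and
sines, which are centred and `[−1,1]`-valued, Hoeffding's lemma
`hasSubgaussianMGF_of_mem_Icc_of_integral_eq_zero`) each such event has probability
`≤ 4e^{−αhn/8}`, and the geometric union bound gives `≤ 8e^{−αn/8} ≤ 8e^{−ε⁴n/64}`.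

* `Discrepancy.unifCube n` — the uniform probability measure on `[0,1)ⁿ`
  (`Measure.pi` of `volume|[0,1)`); `integral_comp_eval_unifCube` (marginals).
* `Discrepancy.measureReal_norm_weylSum_ge_le` — **CDT Lemma 47**: `P(|S_h| ≥ δn) ≤ 4e^{−δ²n/8}`.
* `Discrepancy.exists_large_weylSum` — from `D ≥ ε` to a large Weyl sum (LeVeque + pigeonhole).
* `Discrepancy.measureReal_discrepancy_ge_le` — `P(D ≥ ε) ≤ 8 e^{−ε⁴n/64}`.
* `Discrepancy.discrepancy_concentration` — **CDT Theorem 45** (`∃ C c > 0 …`).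

No named facts.

## References

* [CalegariDimitrovTang2024] arXiv:2408.15403, §4.1 Definition 44 (p. 41), §4.2 Theorem 45,
  Lemma 47 (p. 42).
* [KuipersNiederreiter1974] Ch. 2, Theorem 2.4 (LeVeque's inequality).
-/

noncomputable section

open MeasureTheory Set Filter Topology intervalIntegral

namespace Literature.NumberTheory.DiophantineApproximation

namespace Discrepancy

section Concentration

open ProbabilityTheory

variable {n : ℕ}

/-- The uniform probability measure on `[0,1)ⁿ`. [folklore] -/
def unifCube (n : ℕ) : Measure (Fin n → ℝ) :=
  Measure.pi fun _ : Fin n => (volume.restrict (Ico (0 : ℝ) 1))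

/-- `volume|[0,1)` is a probability measure. [folklore] -/
instance isProbabilityMeasure_restrict_Ico :
    IsProbabilityMeasure (volume.restrict (Ico (0 : ℝ) 1)) :=
  ⟨by simp [Real.volume_Ico]⟩

/-- The uniform measure on the cube is a probability measure. [folklore] -/
instance isProbabilityMeasure_unifCube (n : ℕ) : IsProbabilityMeasure (unifCube n) := by
  unfold unifCube; infer_instance

/-- Marginals: `∫ g(t_i) d(unifCube) = ∫₀¹ g`. [folklore] -/
theorem integral_comp_eval_unifCube (g : ℝ → ℝ) (hg : Measurable g) (i : Fin n) :
    ∫ t, g (t i) ∂(unifCube n) = ∫ x in (0 : ℝ)..1, g x := by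
  have h := (measurePreserving_eval (fun _ : Fin n => (volume.restrict (Ico (0 : ℝ) 1))) i).map_eq
  unfold unifCube
  rw [← integral_map (measurable_pi_apply i).aemeasurable hg.aestronglyMeasurable, h,
    intervalIntegral.integral_of_le zero_le_one, integral_Ico_eq_integral_Ioc]

/-- `∫₀¹ cos(2πhx) dx = 0` for `h ≠ 0`. [folklore] -/
theorem integral_cos_two_pi_mul {h : ℤ} (hh : h ≠ 0) :
    ∫ x in (0 : ℝ)..1, Real.cos (2 * Real.pi * h * x) = 0 := by
  have hc : (2 * Real.pi * h : ℝ) ≠ 0 := by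
    have : (h : ℝ) ≠ 0 := by exact_mod_cast hh
    positivity
  rw [intervalIntegral.integral_comp_mul_left (fun x => Real.cos x) hc, integral_cos]
  simp only [mul_zero, Real.sin_zero, sub_zero, mul_one, smul_eq_mul, mul_eq_zero, inv_eq_zero]
  right
  have : Real.sin (2 * Real.pi * h) = 0 := by
    rw [show (2 * Real.pi * h : ℝ) = ((2 * h : ℤ) : ℝ) * Real.pi by push_cast; ring]
    exact Real.sin_int_mul_pi (2 * h)
  exact this

/-- `∫₀¹ sin(2πhx) dx = 0` for `h ≠ 0`. [folklore] -/
theorem integral_sin_two_pi_mul {h : ℤ} (hh : h ≠ 0) :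
    ∫ x in (0 : ℝ)..1, Real.sin (2 * Real.pi * h * x) = 0 := by
  have hc : (2 * Real.pi * h : ℝ) ≠ 0 := by
    have : (h : ℝ) ≠ 0 := by exact_mod_cast hh
    positivity
  rw [intervalIntegral.integral_comp_mul_left (fun x => Real.sin x) hc, integral_sin]
  simp only [mul_zero, Real.cos_zero, mul_one, smul_eq_mul, mul_eq_zero, inv_eq_zero]
  right
  have : Real.cos (2 * Real.pi * h) = 1 := by
    rw [show (2 * Real.pi * h : ℝ) = (h : ℤ) * (2 * Real.pi) by ring]
    exact Real.cos_int_mul_two_pi h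
  rw [this]; ring

/-- The coordinate cosines `t ↦ cos(2πh tᵢ)` are centred and `[−1,1]`-valued, hence sub-Gaussian
with parameter `1` (Hoeffding's lemma). [folklore] -/
theorem hasSubgaussianMGF_cos {h : ℤ} (hh : h ≠ 0) (i : Fin n) :
    HasSubgaussianMGF (fun t : Fin n → ℝ => Real.cos (2 * Real.pi * h * t i)) 1 (unifCube n) := by
  have hmeas : Measurable fun t : Fin n → ℝ => Real.cos (2 * Real.pi * h * t i) :=
    Real.measurable_cos.comp ((measurable_pi_apply i).const_mul _)
  have h1 := hasSubgaussianMGF_of_mem_Icc_of_integral_eq_zero (μ := unifCube n) (a := -1) (b := 1)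
    hmeas.aemeasurable (ae_of_all _ fun t => ⟨Real.neg_one_le_cos _, Real.cos_le_one _⟩) (by
      have := integral_comp_eval_unifCube (fun x => Real.cos (2 * Real.pi * h * x))
        (Real.measurable_cos.comp (measurable_id.const_mul _)) i
      rw [this, integral_cos_two_pi_mul hh])
  convert h1 using 2
  norm_num

/-- The coordinate sines are sub-Gaussian with parameter `1`. [folklore] -/
theorem hasSubgaussianMGF_sin {h : ℤ} (hh : h ≠ 0) (i : Fin n) :
    HasSubgaussianMGF (fun t : Fin n → ℝ => Real.sin (2 * Real.pi * h * t i)) 1 (unifCube n) := by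
  have hmeas : Measurable fun t : Fin n → ℝ => Real.sin (2 * Real.pi * h * t i) :=
    Real.measurable_sin.comp ((measurable_pi_apply i).const_mul _)
  have h1 := hasSubgaussianMGF_of_mem_Icc_of_integral_eq_zero (μ := unifCube n) (a := -1) (b := 1)
    hmeas.aemeasurable (ae_of_all _ fun t => ⟨Real.neg_one_le_sin _, Real.sin_le_one _⟩) (by
      have := integral_comp_eval_unifCube (fun x => Real.sin (2 * Real.pi * h * x))
        (Real.measurable_sin.comp (measurable_id.const_mul _)) i
      rw [this, integral_sin_two_pi_mul hh])
  convert h1 using 2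
  norm_num

/-- One-sided Hoeffding bound for a sum of independent coordinate functions with sub-Gaussian
parameter `1`: `P(Σᵢ Xᵢ ≥ a) ≤ exp(−a²/(2n))`. [folklore] -/
theorem measureReal_sum_ge_le {g : ℝ → ℝ} (hg : Measurable g)
    (hsub : ∀ i : Fin n, HasSubgaussianMGF (fun t : Fin n → ℝ => g (t i)) 1 (unifCube n))
    {a : ℝ} (ha : 0 ≤ a) :
    (unifCube n).real {t | a ≤ ∑ i, g (t i)} ≤ Real.exp (-a ^ 2 / (2 * n)) := by
  have hind : iIndepFun (fun i (t : Fin n → ℝ) => g (t i)) (unifCube n) := by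
    unfold unifCube
    exact iIndepFun_pi fun i => hg.aemeasurable
  have h := HasSubgaussianMGF.measure_sum_ge_le_of_iIndepFun hind (c := fun _ => 1) (s := Finset.univ)
    (fun i _ => hsub i) ha
  simpa using h

/-- **CDT Lemma 47 (Hoeffding on the circle)** for the Weyl sums of independent uniform points:
`P(|S_h| ≥ δ n) ≤ 4 exp(−δ² n/8)` (`h ≠ 0`, `δ ≥ 0`).
[cite: CalegariDimitrovTang2024, §4.2 Lemma 47 eq. (Hoeffding T bound) (p. 42)] -/
theorem measureReal_norm_weylSum_ge_le {h : ℤ} (hh : h ≠ 0) {δ : ℝ} (hδ : 0 ≤ δ) :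
    (unifCube n).real {t | δ * n ≤ ‖weylSum t h‖} ≤ 4 * Real.exp (-δ ^ 2 * n / 8) := by
  -- real and imaginary parts
  set C : (Fin n → ℝ) → ℝ := fun t => ∑ i, Real.cos (2 * Real.pi * h * t i) with hC
  set S : (Fin n → ℝ) → ℝ := fun t => ∑ i, Real.sin (2 * Real.pi * h * t i) with hS
  have hre : ∀ t : Fin n → ℝ, (weylSum t h).re = C t := by
    intro t
    simp only [weylSum, Complex.re_sum, hC]
    refine Finset.sum_congr rfl fun i _ => ?_
    rw [show (2 * Real.pi * Complex.I * h * (t i : ℂ)) = ((2 * Real.pi * h * t i : ℝ) : ℂ) * Complex.I by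
      push_cast; ring, Complex.exp_mul_I]
    simp only [Complex.add_re, Complex.mul_re, Complex.I_re, Complex.I_im, mul_zero, mul_one,
      sub_zero, ← Complex.ofReal_cos, ← Complex.ofReal_sin, Complex.ofReal_re,
      Complex.ofReal_im]
    ring
  have him : ∀ t : Fin n → ℝ, (weylSum t h).im = S t := by
    intro t
    simp only [weylSum, Complex.im_sum, hS]
    refine Finset.sum_congr rfl fun i _ => ?_
    rw [show (2 * Real.pi * Complex.I * h * (t i : ℂ)) = ((2 * Real.pi * h * t i : ℝ) : ℂ) * Complex.I by
      push_cast; ring, Complex.exp_mul_I]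
    simp only [Complex.add_im, Complex.mul_im, Complex.I_re, Complex.I_im, mul_zero, mul_one,
      add_zero, zero_add, ← Complex.ofReal_cos, ← Complex.ofReal_sin, Complex.ofReal_re,
      Complex.ofReal_im]
  -- inclusion of events
  have hsub : {t : Fin n → ℝ | δ * n ≤ ‖weylSum t h‖} ⊆
      ({t | δ * n / 2 ≤ ∑ i, Real.cos (2 * Real.pi * h * t i)} ∪
        {t | δ * n / 2 ≤ ∑ i, -Real.cos (2 * Real.pi * h * t i)}) ∪
      ({t | δ * n / 2 ≤ ∑ i, Real.sin (2 * Real.pi * h * t i)} ∪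
        {t | δ * n / 2 ≤ ∑ i, -Real.sin (2 * Real.pi * h * t i)}) := by
    intro t ht
    simp only [Set.mem_setOf_eq] at ht
    simp only [Set.mem_union, Set.mem_setOf_eq, Finset.sum_neg_distrib]
    have h1 : ‖weylSum t h‖ ≤ |(weylSum t h).re| + |(weylSum t h).im| :=
      Complex.norm_le_abs_re_add_abs_im _
    rw [hre, him] at h1
    by_contra hcon
    push Not at hcon
    obtain ⟨⟨h2, h3⟩, h4, h5⟩ := hcon
    have hC' : |C t| < δ * n / 2 := abs_lt.mpr ⟨by linarith, h2⟩
    have hS' : |S t| < δ * n / 2 := abs_lt.mpr ⟨by linarith, h4⟩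
    linarith
  have hmc : Measurable fun x : ℝ => Real.cos (2 * Real.pi * h * x) :=
    Real.measurable_cos.comp (measurable_id.const_mul _)
  have hms : Measurable fun x : ℝ => Real.sin (2 * Real.pi * h * x) :=
    Real.measurable_sin.comp (measurable_id.const_mul _)
  have ha : 0 ≤ δ * n / 2 := by positivity
  have e : Real.exp (-(δ * n / 2) ^ 2 / (2 * n)) ≤ Real.exp (-δ ^ 2 * n / 8) := by
    rcases Nat.eq_zero_or_pos n with hn | hn
    · subst hn; simp
    · apply le_of_eq; congr 1
      have : (n : ℝ) ≠ 0 := by exact_mod_cast hn.ne'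
      field_simp; ring
  have b1 := measureReal_sum_ge_le (n := n) hmc (fun i => hasSubgaussianMGF_cos hh i) ha
  have b2 := measureReal_sum_ge_le (n := n) (g := fun x => -Real.cos (2 * Real.pi * h * x)) hmc.neg
    (fun i => (hasSubgaussianMGF_cos hh i).neg) ha
  have b3 := measureReal_sum_ge_le (n := n) hms (fun i => hasSubgaussianMGF_sin hh i) ha
  have b4 := measureReal_sum_ge_le (n := n) (g := fun x => -Real.sin (2 * Real.pi * h * x)) hms.neg
    (fun i => (hasSubgaussianMGF_sin hh i).neg) ha
  calc (unifCube n).real {t | δ * n ≤ ‖weylSum t h‖}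
      ≤ (unifCube n).real (({t | δ * n / 2 ≤ ∑ i, Real.cos (2 * Real.pi * h * t i)} ∪
          {t | δ * n / 2 ≤ ∑ i, -Real.cos (2 * Real.pi * h * t i)}) ∪
        ({t | δ * n / 2 ≤ ∑ i, Real.sin (2 * Real.pi * h * t i)} ∪
          {t | δ * n / 2 ≤ ∑ i, -Real.sin (2 * Real.pi * h * t i)})) :=
        measureReal_mono hsub
    _ ≤ ((unifCube n).real {t | δ * n / 2 ≤ ∑ i, Real.cos (2 * Real.pi * h * t i)} +
          (unifCube n).real {t | δ * n / 2 ≤ ∑ i, -Real.cos (2 * Real.pi * h * t i)}) +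
        ((unifCube n).real {t | δ * n / 2 ≤ ∑ i, Real.sin (2 * Real.pi * h * t i)} +
          (unifCube n).real {t | δ * n / 2 ≤ ∑ i, -Real.sin (2 * Real.pi * h * t i)}) := by
        refine (measureReal_union_le _ _).trans (add_le_add (measureReal_union_le _ _)
          (measureReal_union_le _ _))
    _ ≤ (Real.exp (-(δ * n / 2) ^ 2 / (2 * n)) + Real.exp (-(δ * n / 2) ^ 2 / (2 * n))) +
        (Real.exp (-(δ * n / 2) ^ 2 / (2 * n)) + Real.exp (-(δ * n / 2) ^ 2 / (2 * n))) :=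
        add_le_add (add_le_add b1 b2) (add_le_add b3 b4)
    _ ≤ 4 * Real.exp (-δ ^ 2 * n / 8) := by linarith

/-! ### From LeVeque to a large Weyl sum -/

/-- Telescoping tail: `Σ_{m ≥ 0} 1/((m+K)(m+K+1)) = 1/K`, so `Σ_{m≥0} 1/(m+K+1)² ≤ 1/K` (`K ≥ 1`).
[folklore] -/
theorem tsum_inv_sq_tail_le {K : ℕ} (hK : 1 ≤ K) :
    ∑' m : ℕ, (1 : ℝ) / (((m : ℝ) + K + 1) ^ 2) ≤ 1 / (K : ℝ) := by
  have hKr : (0 : ℝ) < K := by exact_mod_cast hK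
  -- the telescoping series `f m = 1/(m+K) − 1/(m+K+1)` has sum `1/K`
  have htel : HasSum (fun m : ℕ => 1 / ((m : ℝ) + K) - 1 / ((m : ℝ) + K + 1)) (1 / K) := by
    rw [hasSum_iff_tendsto_nat_of_nonneg]
    · have e : ∀ N : ℕ, ∑ m ∈ Finset.range N, (1 / ((m : ℝ) + K) - 1 / ((m : ℝ) + K + 1)) =
          1 / K - 1 / ((N : ℝ) + K) := by
        intro N
        induction N with
        | zero => simp
        | succ N ih => rw [Finset.sum_range_succ, ih]; push_cast; ring
      simp_rw [e]
      have h1 : Tendsto (fun N : ℕ => 1 / ((N : ℝ) + K)) atTop (𝓝 0) :=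
        tendsto_const_nhds.div_atTop (tendsto_natCast_atTop_atTop.atTop_add tendsto_const_nhds)
      simpa using (tendsto_const_nhds (x := (1 : ℝ) / K)).sub h1
    · intro m
      rw [sub_nonneg, one_div_le_one_div (by positivity) (by positivity)]
      linarith
  have hle : ∀ m : ℕ, 1 / (((m : ℝ) + K + 1) ^ 2) ≤ 1 / ((m : ℝ) + K) - 1 / ((m : ℝ) + K + 1) := by
    intro m
    have h0 : (0 : ℝ) < (m : ℝ) + K := by positivity
    rw [div_sub_div _ _ h0.ne' (by positivity), div_le_div_iff₀ (by positivity) (by positivity)]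
    nlinarith
  have hsum : Summable fun m : ℕ => 1 / (((m : ℝ) + K + 1) ^ 2) :=
    Summable.of_nonneg_of_le (fun m => by positivity) hle htel.summable
  calc ∑' m : ℕ, 1 / (((m : ℝ) + K + 1) ^ 2)
      ≤ ∑' m : ℕ, (1 / ((m : ℝ) + K) - 1 / ((m : ℝ) + K + 1)) := hsum.tsum_le_tsum hle htel.summable
    _ = 1 / K := htel.tsum_eq

/-- **From a large discrepancy to a large Weyl sum** (LeVeque + pigeonhole): if `0 < ε ≤ 1`,
`N ≥ 1` and `D(y) ≥ ε`, then with `K = ⌈12/(π²ε³)⌉` and `α = π²ε³/(24 H_K)` (`H_K` the harmonic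
number) some `h ∈ [1, K]` has `‖S_h‖² > α h N²`. [folklore] -/
theorem exists_large_weylSum {N : ℕ} (hN : 0 < N) {y : Fin N → ℝ} (hy0 : ∀ i, 0 ≤ y i)
    (hy1 : ∀ i, y i < 1) {ε : ℝ} (hε : 0 < ε) (hD : ε ≤ boxDiscrepancy y) :
    ∃ h : ℕ, 1 ≤ h ∧ h ≤ ⌈12 / (Real.pi ^ 2 * ε ^ 3)⌉₊ ∧
      Real.pi ^ 2 * ε ^ 3 / (24 * harmonic ⌈12 / (Real.pi ^ 2 * ε ^ 3)⌉₊) * h * N ^ 2 <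
        ‖weylSum y h‖ ^ 2 := by
  set K := ⌈12 / (Real.pi ^ 2 * ε ^ 3)⌉₊ with hK
  have hπ : 0 < Real.pi ^ 2 := by positivity
  have hK1 : 1 ≤ K := Nat.one_le_iff_ne_zero.mpr (Nat.ceil_pos.mpr (by positivity)).ne'
  have hKr : 12 / (Real.pi ^ 2 * ε ^ 3) ≤ K := Nat.le_ceil _
  have hKpos : (0 : ℝ) < K := by exact_mod_cast hK1
  have hNr : (0 : ℝ) < N := by exact_mod_cast hN
  set g : ℕ → ℝ := fun m => ‖weylSum y (m + 1)‖ ^ 2 / (((m : ℝ) + 1) ^ 2 * N ^ 2) with hg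
  have hg0 : ∀ m, 0 ≤ g m := fun m => by simp only [hg]; positivity
  have hgle : ∀ m, g m ≤ 1 / (((m : ℝ) + 1) ^ 2) := by
    intro m
    simp only [hg]
    rw [div_le_div_iff₀ (by positivity) (by positivity), one_mul]
    have := norm_weylSum_le y (m + 1)
    have h2 : ‖weylSum y (m + 1)‖ ^ 2 ≤ (N : ℝ) ^ 2 := pow_le_pow_left₀ (norm_nonneg _) this 2
    nlinarith [sq_nonneg ((m : ℝ) + 1)]
  -- summability and the LeVeque bound
  have hsum1 : Summable fun m : ℕ => 1 / (((m : ℝ) + 1) ^ 2) := by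
    have h := (summable_nat_add_iff 1).mpr ((Real.summable_one_div_nat_pow (p := 2)).mpr one_lt_two)
    simpa using h
  have hgs : Summable g := Summable.of_nonneg_of_le hg0 hgle hsum1
  have hLV := leVeque hN hy0 hy1
  have hε3 : ε ^ 3 ≤ 6 / Real.pi ^ 2 * ∑' m, g m :=
    (pow_le_pow_left₀ hε.le hD 3).trans hLV
  -- split the sum at `K`
  have hsplit := (hgs.sum_add_tsum_nat_add K).symm
  have htail : ∑' m, g (m + K) ≤ 1 / K := by
    calc ∑' m, g (m + K) ≤ ∑' m : ℕ, 1 / (((m : ℝ) + K + 1) ^ 2) := by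
          refine Summable.tsum_le_tsum (fun m => ?_) ((summable_nat_add_iff K).mpr hgs) ?_
          · have := hgle (m + K); push_cast at this; exact this
          · have := (summable_nat_add_iff K).mpr hsum1
            refine this.congr fun m => ?_
            push_cast; ring_nf
      _ ≤ 1 / K := tsum_inv_sq_tail_le hK1
  -- the head must be large
  have hhead : Real.pi ^ 2 * ε ^ 3 / 12 ≤ ∑ m ∈ Finset.range K, g m := by
    have h1 : ε ^ 3 ≤ 6 / Real.pi ^ 2 * (∑ m ∈ Finset.range K, g m + 1 / K) := by
      calc ε ^ 3 ≤ 6 / Real.pi ^ 2 * ∑' m, g m := hε3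
        _ = 6 / Real.pi ^ 2 * (∑ m ∈ Finset.range K, g m + ∑' m, g (m + K)) := by rw [← hsplit]
        _ ≤ 6 / Real.pi ^ 2 * (∑ m ∈ Finset.range K, g m + 1 / K) := by gcongr
    have h2 : 6 / Real.pi ^ 2 * (1 / K) ≤ ε ^ 3 / 2 := by
      rw [div_mul_div_comm, div_le_div_iff₀ (by positivity) two_pos]
      have : 12 ≤ Real.pi ^ 2 * ε ^ 3 * K := by
        have := (div_le_iff₀ (by positivity)).mp hKr; linarith
      nlinarith
    have h3 : ε ^ 3 / 2 ≤ 6 / Real.pi ^ 2 * ∑ m ∈ Finset.range K, g m := by nlinarith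
    rw [div_le_iff₀ (by norm_num : (0:ℝ) < 12)]
    have := (div_mul_eq_mul_div 6 (Real.pi ^ 2) _) ▸ h3
    rw [le_div_iff₀ hπ] at this
    nlinarith
  -- pigeonhole against `Σ_{h ≤ K} α/h = α H_K`
  set α := Real.pi ^ 2 * ε ^ 3 / (24 * harmonic K) with hα
  have hH1 : (1 : ℝ) ≤ harmonic K := by
    rw [harmonic]
    push_cast
    have := Finset.single_le_sum (f := fun i : ℕ => (((i : ℝ) + 1))⁻¹) (fun i _ => by positivity)
      (Finset.mem_range.mpr hK1)
    simpa using this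
  have hH : (0 : ℝ) < harmonic K := by linarith
  by_contra hcon
  push Not at hcon
  -- every `g m`, `m < K`, is at most `α/(m+1)`
  have hterm : ∀ m ∈ Finset.range K, g m ≤ α / ((m : ℝ) + 1) := by
    intro m hm
    have hm' : m + 1 ≤ K := Finset.mem_range.mp hm
    have h := hcon (m + 1) (Nat.le_add_left 1 m) hm'
    simp only [hg]
    rw [div_le_div_iff₀ (by positivity) (by positivity)]
    push_cast at h ⊢
    nlinarith [sq_nonneg ((m:ℝ)+1)]
  have hsumle : ∑ m ∈ Finset.range K, g m ≤ α * harmonic K := by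
    calc ∑ m ∈ Finset.range K, g m ≤ ∑ m ∈ Finset.range K, α / ((m : ℝ) + 1) :=
          Finset.sum_le_sum hterm
      _ = α * harmonic K := by
          rw [harmonic]
          push_cast
          rw [Finset.mul_sum]
          exact Finset.sum_congr rfl fun m _ => by rw [div_eq_mul_inv]
  have : α * harmonic K = Real.pi ^ 2 * ε ^ 3 / 24 := by
    rw [hα]; field_simp
  have hpos : 0 < Real.pi ^ 2 * ε ^ 3 := by positivity
  linarith

/-! ### CDT Theorem 45 -/

/-- Every local discrepancy, hence the box discrepancy, is at most `1`. [folklore] -/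
theorem boxDiscrepancy_le_one {N : ℕ} (y : Fin N → ℝ) : boxDiscrepancy y ≤ 1 := by
  unfold boxDiscrepancy
  refine csSup_le ⟨_, ⟨(0, 0), ⟨le_rfl, le_rfl, zero_le_one⟩, rfl⟩⟩ ?_
  rintro _ ⟨⟨a, b⟩, ⟨ha, hab, hb⟩, rfl⟩
  simp only
  unfold localDisc
  have h1 : 0 ≤ b - a := by linarith
  have h2 : b - a ≤ 1 := by linarith
  have h3 : 0 ≤ ((Finset.univ.filter fun n => a ≤ y n ∧ y n ≤ b).card : ℝ) / N := by positivity
  have h4 : ((Finset.univ.filter fun n => a ≤ y n ∧ y n ≤ b).card : ℝ) / N ≤ 1 := by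
    rcases Nat.eq_zero_or_pos N with hN | hN
    · subst hN; simp
    · rw [div_le_one (by exact_mod_cast hN)]
      exact_mod_cast (Finset.card_le_univ _).trans (by simp)
  rw [abs_le]; constructor <;> linarith

/-- The parameter `α = π²ε³/(24 H_K)`, `K = ⌈12/(π²ε³)⌉`, is at least `ε⁴/8` for `0 < ε ≤ 1`.
[folklore] -/
theorem alpha_ge {ε : ℝ} (hε : 0 < ε) (hε1 : ε ≤ 1) :
    ε ^ 4 / 8 ≤ Real.pi ^ 2 * ε ^ 3 / (24 * harmonic ⌈12 / (Real.pi ^ 2 * ε ^ 3)⌉₊) := by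
  set K := ⌈12 / (Real.pi ^ 2 * ε ^ 3)⌉₊ with hK
  have hπ3 : 3 < Real.pi := Real.pi_gt_three
  have hπ : 9 < Real.pi ^ 2 := by nlinarith
  have hK1 : 1 ≤ K := Nat.one_le_iff_ne_zero.mpr (Nat.ceil_pos.mpr (by positivity)).ne'
  -- `K ≤ 3/ε³`
  have hε3 : 0 < ε ^ 3 := by positivity
  have hKle : (K : ℝ) ≤ 3 / ε ^ 3 := by
    have h1 : (K : ℝ) < 12 / (Real.pi ^ 2 * ε ^ 3) + 1 := Nat.ceil_lt_add_one (by positivity)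
    have h2 : 12 / (Real.pi ^ 2 * ε ^ 3) ≤ 12 / (9 * ε ^ 3) := by
      apply div_le_div_of_nonneg_left (by norm_num) (by positivity)
      exact mul_le_mul_of_nonneg_right hπ.le hε3.le
    have h3 : (1 : ℝ) ≤ 1 / ε ^ 3 := by
      rw [le_div_iff₀ hε3, one_mul]
      calc ε ^ 3 ≤ 1 ^ 3 := pow_le_pow_left₀ hε.le hε1 3
        _ = 1 := one_pow 3
    have h6 : ε ^ 3 * ε ^ 3 ≤ ε ^ 3 * 1 :=
      mul_le_mul_of_nonneg_left (pow_le_one₀ hε.le hε1) hε3.le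
    have : 12 / (9 * ε ^ 3) + 1 ≤ 3 / ε ^ 3 := by
      rw [div_add_one (by positivity), div_le_div_iff₀ (by positivity) hε3]
      nlinarith
    linarith
  -- `1 + log K ≤ 3/ε`
  have hKpos : (0 : ℝ) < K := by exact_mod_cast hK1
  have hlogK : 1 + Real.log K ≤ 3 / ε := by
    have h1 : Real.log K ≤ Real.log (3 / ε ^ 3) := Real.log_le_log hKpos hKle
    have h2 : Real.log (3 / ε ^ 3) = Real.log 3 + 3 * Real.log (1 / ε) := by
      rw [Real.log_div (by norm_num) hε3.ne', one_div, Real.log_inv, Real.log_pow]; ring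
    have h3 : Real.log 3 ≤ 3 - 1 := Real.log_le_sub_one_of_pos (by norm_num)
    have h4 : Real.log (1 / ε) ≤ 1 / ε - 1 := Real.log_le_sub_one_of_pos (by positivity)
    have h5 : 1 / ε = 3 / ε / 3 := by ring
    nlinarith
  -- harmonic bound
  have hH : (harmonic K : ℝ) ≤ 1 + Real.log K := by exact_mod_cast harmonic_le_one_add_log K
  have hH1 : (1 : ℝ) ≤ harmonic K := by
    rw [harmonic]
    push_cast
    have := Finset.single_le_sum (f := fun i : ℕ => (((i : ℝ) + 1))⁻¹) (fun i _ => by positivity)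
      (Finset.mem_range.mpr hK1)
    simpa using this
  have hHε : (harmonic K : ℝ) ≤ 3 / ε := hH.trans hlogK
  -- conclude
  rw [div_le_div_iff₀ (by norm_num) (by positivity)]
  have : 24 * (harmonic K : ℝ) ≤ 72 / ε := by
    have := mul_le_mul_of_nonneg_left hHε (by norm_num : (0 : ℝ) ≤ 24)
    linarith [show (24 : ℝ) * (3 / ε) = 72 / ε by ring]
  calc ε ^ 4 * (24 * (harmonic K : ℝ)) ≤ ε ^ 4 * (72 / ε) := by gcongr
    _ = 72 * ε ^ 3 := by field_simp
    _ ≤ Real.pi ^ 2 * ε ^ 3 * 8 := by nlinarith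

/-- **CDT Theorem 45 (measure concentration of the discrepancy)**, explicit form: for independent
uniform points `t₁,…,t_n ∈ [0,1)`, `P(D(t) ≥ ε) ≤ 8 exp(−ε⁴ n/64)` for every `ε > 0` and `n`
(CDT: `C e^{−cε⁴n}` with absolute constants, e.g. `C = 100`, `c = 1/300`, via Erdős–Turán +
Hoeffding; here via LeVeque's inequality + Hoeffding, Lemma 47).
[cite: CalegariDimitrovTang2024, §4.2 Theorem 45 (p. 42)] -/
theorem measureReal_discrepancy_ge_le (n : ℕ) {ε : ℝ} (hε : 0 < ε) :
    (unifCube n).real {t | (∀ i, t i ∈ Ico (0 : ℝ) 1) ∧ ε ≤ boxDiscrepancy t} ≤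
      8 * Real.exp (-(ε ^ 4 * n / 64)) := by
  set E := {t : Fin n → ℝ | (∀ i, t i ∈ Ico (0 : ℝ) 1) ∧ ε ≤ boxDiscrepancy t} with hE
  have hprob : (unifCube n).real E ≤ 1 := measureReal_le_one
  have hexp0 : 0 < Real.exp (-(ε ^ 4 * n / 64)) := Real.exp_pos _
  -- trivial cases: `ε > 1` (empty event) and `n = 0`
  rcases lt_or_ge 1 ε with hε1 | hε1
  · have hempty : E = ∅ := by
      rw [hE, Set.eq_empty_iff_forall_notMem]
      intro t ht
      exact absurd (ht.2.trans (boxDiscrepancy_le_one t)) (not_le.mpr hε1)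
    rw [hempty, measureReal_empty]; positivity
  rcases Nat.eq_zero_or_pos n with hn | hn
  · subst hn
    simp only [Nat.cast_zero, mul_zero, zero_div, neg_zero, Real.exp_zero, mul_one]
    linarith
  -- parameters
  set K := ⌈12 / (Real.pi ^ 2 * ε ^ 3)⌉₊ with hK
  set α := Real.pi ^ 2 * ε ^ 3 / (24 * harmonic K) with hα
  have hα0 : 0 < α := by
    have := alpha_ge hε hε1
    have : 0 < ε ^ 4 / 8 := by positivity
    linarith
  -- the event is contained in a union of large-Weyl-sum events
  set F : ℕ → Set (Fin n → ℝ) := fun j => {t | Real.sqrt (α * (j + 1)) * n ≤ ‖weylSum t ((j + 1 : ℕ) : ℤ)‖}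
    with hF
  have hsubset : E ⊆ ⋃ j ∈ Finset.range K, F j := by
    intro t ht
    obtain ⟨h, h1, hK', hlt⟩ := exists_large_weylSum hn (fun i => (ht.1 i).1) (fun i => (ht.1 i).2)
      hε ht.2
    simp only [Set.mem_iUnion, Finset.mem_range, exists_prop]
    refine ⟨h - 1, by omega, ?_⟩
    simp only [hF, Set.mem_setOf_eq]
    have hh : (h - 1 + 1 : ℕ) = h := by omega
    rw [hh]
    have hcast : ((h - 1 : ℕ) : ℝ) + 1 = h := by
      rw [Nat.cast_sub h1]; push_cast; ring
    rw [hcast]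
    -- `√(α h) n ≤ ‖S_h‖` from `α h n² < ‖S_h‖²`
    have hlt' : (Real.sqrt (α * h) * n) ^ 2 < ‖weylSum t h‖ ^ 2 := by
      rw [mul_pow, Real.sq_sqrt (by positivity)]
      rw [← hα] at hlt
      linarith
    exact le_of_lt (lt_of_pow_lt_pow_left₀ 2 (norm_nonneg _) hlt')
  -- the union bound with Hoeffding
  set r := Real.exp (-(α * n / 8)) with hr
  have hr0 : 0 < r := Real.exp_pos _
  have hr1 : r < 1 := Real.exp_lt_one_iff.mpr (by
    have : (0 : ℝ) < n := by exact_mod_cast hn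
    have := mul_pos hα0 this; linarith)
  have hFj : ∀ j : ℕ, (unifCube n).real (F j) ≤ 4 * r ^ (j + 1) := by
    intro j
    have h := measureReal_norm_weylSum_ge_le (n := n) (h := ((j + 1 : ℕ) : ℤ))
      (by exact_mod_cast Nat.succ_ne_zero j) (Real.sqrt_nonneg (α * (j + 1)))
    refine h.trans (le_of_eq ?_)
    rw [Real.sq_sqrt (by positivity), hr, ← Real.exp_nat_mul]
    congr 1
    push_cast
    ring
  have hunion : (unifCube n).real E ≤ 4 * (r / (1 - r)) := by
    calc (unifCube n).real E ≤ (unifCube n).real (⋃ j ∈ Finset.range K, F j) :=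
          measureReal_mono hsubset (measure_ne_top _ _)
      _ ≤ ∑ j ∈ Finset.range K, (unifCube n).real (F j) := measureReal_biUnion_finset_le _ _
      _ ≤ ∑ j ∈ Finset.range K, 4 * r ^ (j + 1) := Finset.sum_le_sum fun j _ => hFj j
      _ = 4 * r * ∑ j ∈ Finset.range K, r ^ j := by
          rw [Finset.mul_sum]
          exact Finset.sum_congr rfl fun j _ => by ring
      _ ≤ 4 * r * (1 - r)⁻¹ := by
          gcongr
          exact ((summable_geometric_of_lt_one hr0.le hr1).sum_le_tsum (Finset.range K)
            (fun j _ => pow_nonneg hr0.le j)).trans (tsum_geometric_of_lt_one hr0.le hr1).le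
      _ = 4 * (r / (1 - r)) := by rw [div_eq_mul_inv]; ring
  -- `P ≤ 8 r`
  have h8 : (unifCube n).real E ≤ 8 * r := by
    rcases le_or_gt r (1 / 2) with hhalf | hhalf
    · have : r / (1 - r) ≤ 2 * r := by
        rw [div_le_iff₀ (by linarith)]; nlinarith
      linarith
    · linarith
  -- `r ≤ exp(−ε⁴ n/64)`
  have hrle : r ≤ Real.exp (-(ε ^ 4 * n / 64)) := by
    rw [hr, Real.exp_le_exp]
    have := alpha_ge hε hε1
    have hn' : (0 : ℝ) ≤ n := Nat.cast_nonneg n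
    rw [← hα] at this
    nlinarith
  linarith

/-- **CDT Theorem 45** as printed (existential absolute constants).
[cite: CalegariDimitrovTang2024, §4.2 Theorem 45 (p. 42)] -/
theorem discrepancy_concentration :
    ∃ C c : ℝ, 0 < C ∧ 0 < c ∧ ∀ (n : ℕ) (ε : ℝ), 0 < ε →
      (unifCube n).real {t | (∀ i, t i ∈ Ico (0 : ℝ) 1) ∧ ε ≤ boxDiscrepancy t} ≤
        C * Real.exp (-(c * ε ^ 4 * n)) :=
  ⟨8, 1 / 64, by norm_num, by norm_num, fun n ε hε => by
    have h := measureReal_discrepancy_ge_le n hε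
    convert h using 3; ring⟩

end Concentration

end Discrepancy

end Literature.NumberTheory.DiophantineApproximation
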